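/-
Copyright (c) 2026 the pub-hodgecm-mathlib formalisation cell (harness21).  Prover seat hodgecm-mathlib-K2Liu-p13 (g2), Track B «K2-LIT»,
#184♮ = hLiu418 = `stmt-HodgeConjecture-24832`; Road I v3 organ U1-CT-ind STAGE 2 (Q2), file F4-3a (LEAD F0P6-plan (g14) 10:39:33Z «F4 → F5 → D-U1 stage 3 =»;
CENSUS-Q2-F4 `K2/K2Liu-p13/g2/CENSUS-Q2-F4-KlingenUnfold.K2Liu-p13-g2.md` §1 F4-3).
-/
import Summits.HodgeConjecture.HodgeConjecture.Theorems.K2LiuKlingenUnipotentNormal   -- ★ F4-1e: `mem_klingenUnip_iff_entries` (+ ★ F4-1d `row_three_of_mem_klingen`, ★ F4-0, ★ F1)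
import HarnessLib

/-!
# Crux `HLiu418`, Road I v3, organ U1 stage 2 (Q2), file F4-3a: THE LEVI DECOMPOSITION `Q = M_Q ⋉ N_Q` OF THE KLINGEN PARABOLIC OF `U(J₄)` AND THE
# `ξ`-CONJUGATION TEST — `q = m_Q(q₀₀, q|_{⟨e₁,e₂⟩}) · n`, `ξ x ξ⁻¹ ∈ P ⟺ x₀₁ = x₀₃ = x₂₁ = x₂₃ = 0`, `ξ m_Q(a,g′) n_Q(y,z,t) ξ⁻¹ ∈ P ⟺ g′₁₀ = 0 ∧ y = 0 ∧ t = 0`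

Cell `hodgecm-mathlib`, crux item hLiu418 = `stmt-HodgeConjecture-24832`; squad K2 ∕ K2Liu; LEAD F0P6-plan (g14), co-dealer K2E5-plan (g7); prover K2Liu-p13 (g2).
THEOREMS ONLY (no `def`, no instance, no notation, no named-fact hypothesis, no `sorry`); lane `--supports stmt-HodgeConjecture-24832 --as helper` (count-neutral).
Pure algebra over a commutative ring `R` with an involutive ring endomorphism `σ` (B1a's frame ★ `K2LiuDoubledUTwoTwoBorelFrame`, ★ F1 `K2LiuKlingenParabolicDefs`:
`G = U(J₄)(R,σ)`, `P = siegelFour` (corner test `g₂₀ = g₂₁ = g₃₀ = g₃₁ = 0`), `Q = klingen` (column test `g₁₀ = g₂₀ = g₃₀ = 0`), `M_Q = {m_Q(a, g′)}` (★ `klingenLevi`),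
`N_Q = {n_Q(y,z,t)}` (★ F4-0 `klingenUnip`), `ξ = weylXi` (`ξ e₀ = e₂, ξ e₁ = e₀, ξ e₂ = e₃, ξ e₃ = e₁`)).
WHY.  The `ξ`-cell `C₁ᶜ = {⟦Ψ(ξ q)⟧ : q ∈ Q(L⁺)}` of the Q-constant term (★ F4 `K2LiuKlingenConstantTermUnfold`) is regrouped into `N_Q(L⁺)`-orbits (★ F4-2b); naming the orbits
(by `B₂(L⁺)\U(J₂)(L⁺)`) and their stabilisers (`Ψ(m⁻¹ u₊(L⁺) m)`) needs exactly the three algebraic facts of this file (file F4-3b `K2LiuKlingenCellXiOrbits` transports them to `H`):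
* §1 **`weylXi_conj_mem_siegelFour_iff`** — `ξ` is a permutation matrix, so `ξ x ξ⁻¹ ∈ P ⟺ x₀₁ = 0 ∧ x₀₃ = 0 ∧ x₂₁ = 0 ∧ x₂₃ = 0` for EVERY `x ∈ U(J₄)` (the four corner entries of
  `ξ x ξ⁻¹` are `x₀₁, x₀₃, x₂₁, x₂₃`: `coe_weylXi_conj_apply`);
* §2 **`weylXi_conj_klingenLevi_mul_nKlingen_mem_siegelFour_iff`** — `ξ · m_Q(a,g′) n_Q(y,z,t) · ξ⁻¹ ∈ P ⟺ g′₁₀ = 0 ∧ y = 0 ∧ t = 0` (rows `0` and `2` of `m_Q(a,g′)·x`: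
  `klingenLevi_mul_apply_zero`, `klingenLevi_mul_apply_two`); in particular `ξ m_Q(a,g′) ξ⁻¹ ∈ P ⟺ g′₁₀ = 0` (`Q ∩ ξ⁻¹Pξ = m_Q(GL₁ × B₂) · u₊`) and ★ F4-0 §3 is the case
  `a = 1, g′ = 1`;
* §3 **`exists_klingenLevi_mul_eq`** (LEVI DECOMPOSITION) — every `q ∈ Q` is `m_Q(a, g′) · n` with `n ∈ N_Q`, `a = q₀₀` (a unit: `σ(q₃₃) q₀₀ = 1`, ★ F4-1d) and `g′ = q|_{⟨e₁,e₂⟩}` the middle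
  block, which is unitary for `J₂` (`midBlock_unitarity_of_mem_klingen`: unitarity of `q` read on the middle block with the zero patterns of ★ F4-1d); `n := m⁻¹ q` lies in `N_Q` by
  ★ F4-1e `mem_klingenUnip_iff_entries`.  Stated with the matrix of `g′` BY VALUE (no constructor is named).
[MoeglinWaldspurger1995, I.2.1 (`P = MN`)], [Xiong2013, §7 Lemma 7.1], [Casselman1980, §3], [Rogawski1990, §1.9–§1.10], [BruhatTits1972, (4.4.3)].
HONEST LABEL.  Count-neutral helper: `HC_CM` is proved only modulo the 7 printed citations (2 remaining named inputs: hLiu418 = `stmt-HodgeConjecture-24832`,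
h413 = `stmt-HodgeConjecture-24833`) until rung 0 closes.
-/

set_option autoImplicit false
set_option linter.dupNamespace false -- the mandated namespace repeats `HodgeConjecture.HodgeConjecture`

noncomputable section

open scoped Matrix

namespace Summit.HodgeConjecture.HodgeConjecture.Cruxes.HLiu418.K2LiuKlingenLeviDecomposition

open Literature.NumberTheory.Automorphic
open Summit.HodgeConjecture.HodgeConjecture.Cruxes.HLiu418.K2LiuDoubledUTwoTwoBorelFrame
open Summit.HodgeConjecture.HodgeConjecture.Cruxes.HLiu418.K2LiuDoubledUTwoTwoLevi (antidiagTwo antidiagTwo_mul_self)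
open Summit.HodgeConjecture.HodgeConjecture.Cruxes.HLiu418.K2LiuKlingenParabolicDefs
open Summit.HodgeConjecture.HodgeConjecture.Cruxes.HLiu418.K2LiuKlingenUnipotentDefs
open Summit.HodgeConjecture.HodgeConjecture.Cruxes.HLiu418.K2LiuKlingenConjUnipotent (col_zero_unitarity_of_mem_klingen row_three_of_mem_klingen)
open Summit.HodgeConjecture.HodgeConjecture.Cruxes.HLiu418.K2LiuKlingenUnipotentNormal (mem_klingenUnip_iff_entries)

variable {R : Type*} [CommRing R] {σ : R →+* R}

/-! ## §1 The `ξ`-conjugation test: `ξ x ξ⁻¹ ∈ P ⟺ x₀₁ = x₀₃ = x₂₁ = x₂₃ = 0` -/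

/-- **the four Siegel corner entries of `ξ x ξ⁻¹`** are `x₀₁, x₀₃, x₂₁, x₂₃` (`ξ` permutes the basis: `(ξ x ξ⁻¹)_{π i, π j} = x_{i j}`, `π = (0 2 3 1)`).
[cite: Xiong2013, §7 Lemma 7.1] [cite: Casselman1980, §3] -/
theorem coe_weylXi_conj_apply (x : unitaryGroupOfForm σ ((StdForm.antidiagonal 4).over R)) :
    ((((weylXi R σ * x * (weylXi R σ)⁻¹ : unitaryGroupOfForm σ _)) : GL (Fin 4) R) : Matrix (Fin 4) (Fin 4) R) 2 0 =
        ((x : GL (Fin 4) R) : Matrix (Fin 4) (Fin 4) R) 0 1 ∧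
      ((((weylXi R σ * x * (weylXi R σ)⁻¹ : unitaryGroupOfForm σ _)) : GL (Fin 4) R) : Matrix (Fin 4) (Fin 4) R) 2 1 =
        ((x : GL (Fin 4) R) : Matrix (Fin 4) (Fin 4) R) 0 3 ∧
      ((((weylXi R σ * x * (weylXi R σ)⁻¹ : unitaryGroupOfForm σ _)) : GL (Fin 4) R) : Matrix (Fin 4) (Fin 4) R) 3 0 =
        ((x : GL (Fin 4) R) : Matrix (Fin 4) (Fin 4) R) 2 1 ∧
      ((((weylXi R σ * x * (weylXi R σ)⁻¹ : unitaryGroupOfForm σ _)) : GL (Fin 4) R) : Matrix (Fin 4) (Fin 4) R) 3 1 =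
        ((x : GL (Fin 4) R) : Matrix (Fin 4) (Fin 4) R) 2 3 := by
  rw [Subgroup.coe_mul, Units.val_mul, Subgroup.coe_mul, Units.val_mul, coe_weylXi, coe_weylXi_inv]
  simp only [Matrix.mul_apply, Fin.sum_univ_four]
  refine ⟨?_, ?_, ?_, ?_⟩ <;> simp [weylXiM]

/-- **THE `ξ`-CONJUGATION TEST**: `ξ x ξ⁻¹ ∈ P ⟺ x₀₁ = 0 ∧ x₀₃ = 0 ∧ x₂₁ = 0 ∧ x₂₃ = 0`, for every `x ∈ U(J₄)(R, σ)`.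
[cite: Xiong2013, §7 Lemma 7.1] [cite: Casselman1980, §3] [cite: MoeglinWaldspurger1995, II.1.7] -/
theorem weylXi_conj_mem_siegelFour_iff (x : unitaryGroupOfForm σ ((StdForm.antidiagonal 4).over R)) :
    weylXi R σ * x * (weylXi R σ)⁻¹ ∈ siegelFour R σ ↔
      ((x : GL (Fin 4) R) : Matrix (Fin 4) (Fin 4) R) 0 1 = 0 ∧ ((x : GL (Fin 4) R) : Matrix (Fin 4) (Fin 4) R) 0 3 = 0 ∧
        ((x : GL (Fin 4) R) : Matrix (Fin 4) (Fin 4) R) 2 1 = 0 ∧ ((x : GL (Fin 4) R) : Matrix (Fin 4) (Fin 4) R) 2 3 = 0 := by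
  obtain ⟨h20, h21, h30, h31⟩ := coe_weylXi_conj_apply x
  rw [mem_siegelFour_iff, h20, h21, h30, h31]

/-! ## §2 Rows `0` and `2` of `m_Q(a, g′) · x`, and the test on `M_Q · N_Q` -/

/-- **row `0` of `m_Q(a, g′) · x` is `a · (row 0 of x)`**. [cite: Xiong2013, §7 Lemma 7.1] -/
theorem klingenLevi_mul_apply_zero (hσ : ∀ x, σ (σ x) = x) (a : Rˣ) (g : unitaryGroupOfForm σ ((StdForm.antidiagonal 2).over R))
    (x : unitaryGroupOfForm σ ((StdForm.antidiagonal 4).over R)) (j : Fin 4) :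
    (((klingenLevi R σ hσ a g * x : unitaryGroupOfForm σ _) : GL (Fin 4) R) : Matrix (Fin 4) (Fin 4) R) 0 j =
      (a : R) * ((x : GL (Fin 4) R) : Matrix (Fin 4) (Fin 4) R) 0 j := by
  rw [Subgroup.coe_mul, Units.val_mul, Matrix.mul_apply, coe_klingenLevi]
  simp [klingenLeviM, Fin.sum_univ_four]

/-- **row `2` of `m_Q(a, g′) · x` is `g′₁₀ · (row 1 of x) + g′₁₁ · (row 2 of x)`**. [cite: Xiong2013, §7 Lemma 7.1] -/
theorem klingenLevi_mul_apply_two (hσ : ∀ x, σ (σ x) = x) (a : Rˣ) (g : unitaryGroupOfForm σ ((StdForm.antidiagonal 2).over R))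
    (x : unitaryGroupOfForm σ ((StdForm.antidiagonal 4).over R)) (j : Fin 4) :
    (((klingenLevi R σ hσ a g * x : unitaryGroupOfForm σ _) : GL (Fin 4) R) : Matrix (Fin 4) (Fin 4) R) 2 j =
      ((g : GL (Fin 2) R) : Matrix (Fin 2) (Fin 2) R) 1 0 * ((x : GL (Fin 4) R) : Matrix (Fin 4) (Fin 4) R) 1 j +
        ((g : GL (Fin 2) R) : Matrix (Fin 2) (Fin 2) R) 1 1 * ((x : GL (Fin 4) R) : Matrix (Fin 4) (Fin 4) R) 2 j := by
  rw [Subgroup.coe_mul, Units.val_mul, Matrix.mul_apply, coe_klingenLevi]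
  simp [klingenLeviM, Fin.sum_univ_four]

/-- **THE TEST ON `M_Q · N_Q`**: `ξ · m_Q(a, g′) n_Q(y, z, t) · ξ⁻¹ ∈ P ⟺ g′₁₀ = 0 ∧ y = 0 ∧ t = 0` — i.e. `Q ∩ ξ⁻¹ P ξ = m_Q(GL₁ × B₂) · u_{e₁+e₂}`: the Levi part must
lie in E1's Borel `B₂` of `U(J₂)` (corner `g′₁₀ = 0`) and the unipotent part in `u_{e₁+e₂}` (★ F4-0 §3 is `a = 1, g′ = 1`).
[cite: Xiong2013, §7 Lemma 7.1] [cite: MoeglinWaldspurger1995, II.1.7] [cite: Casselman1980, §3] -/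
theorem weylXi_conj_klingenLevi_mul_nKlingen_mem_siegelFour_iff (hσ : ∀ x, σ (σ x) = x) (a : Rˣ) (g : unitaryGroupOfForm σ ((StdForm.antidiagonal 2).over R))
    (y : R) (hy : σ y = -y) (z t : R) :
    weylXi R σ * (klingenLevi R σ hσ a g * nKlingen R σ hσ y hy z t) * (weylXi R σ)⁻¹ ∈ siegelFour R σ ↔
      ((g : GL (Fin 2) R) : Matrix (Fin 2) (Fin 2) R) 1 0 = 0 ∧ y = 0 ∧ t = 0 := by
  rw [weylXi_conj_mem_siegelFour_iff, klingenLevi_mul_apply_zero, klingenLevi_mul_apply_zero, klingenLevi_mul_apply_two, klingenLevi_mul_apply_two,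
    coe_nKlingen]
  simp only [nKlingenM, Matrix.of_apply, Matrix.cons_val', Matrix.cons_val_zero, Matrix.cons_val_one, Matrix.cons_val, Matrix.empty_val',
    Matrix.cons_val_fin_one, mul_one, mul_zero, add_zero]
  constructor
  · rintro ⟨h1, h2, h3, -⟩
    have ht : t = 0 := by simpa using (a.isUnit.mul_right_eq_zero).1 h1
    have hyz : y - z * σ t = 0 := (a.isUnit.mul_right_eq_zero).1 h2
    rw [ht, map_zero, mul_zero, sub_zero] at hyz
    exact ⟨h3, hyz, ht⟩
  · rintro ⟨hg, rfl, rfl⟩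
    simp [hg]

/-- **`ξ m_Q(a, g′) ξ⁻¹ ∈ P ⟺ g′₁₀ = 0`** (`M_Q ∩ ξ⁻¹ P ξ = m_Q(GL₁ × B₂)`). [cite: MoeglinWaldspurger1995, II.1.7] [cite: Xiong2013, §7 Lemma 7.1] -/
theorem weylXi_conj_klingenLevi_mem_siegelFour_iff (hσ : ∀ x, σ (σ x) = x) (a : Rˣ) (g : unitaryGroupOfForm σ ((StdForm.antidiagonal 2).over R)) :
    weylXi R σ * klingenLevi R σ hσ a g * (weylXi R σ)⁻¹ ∈ siegelFour R σ ↔ ((g : GL (Fin 2) R) : Matrix (Fin 2) (Fin 2) R) 1 0 = 0 := by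
  have h := weylXi_conj_klingenLevi_mul_nKlingen_mem_siegelFour_iff hσ a g 0 skew_zero 0 0
  rw [nKlingen_zero hσ, mul_one] at h
  rw [h]
  simp

/-- **`ξ m_Q(a, 1) ξ⁻¹ ∈ P`**: the `GL₁`-factor of the Levi is invisible in `P_Δ(L⁺)\H(L⁺)` after `ξ` (its modulus is what shifts `s ↦ 1 − s` in term 2, file F5).
[cite: Xiong2013, §4 Prop. 4.1] [cite: GanTakeda2011SiegelWeil, §7.2 p. 23] -/
theorem weylXi_conj_klingenLevi_one_mem_siegelFour (hσ : ∀ x, σ (σ x) = x) (a : Rˣ) :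
    weylXi R σ * klingenLevi R σ hσ a 1 * (weylXi R σ)⁻¹ ∈ siegelFour R σ := by
  rw [weylXi_conj_klingenLevi_mem_siegelFour_iff]
  simp

/-! ## §3 The Levi decomposition `q = m_Q(q₀₀, q|_{⟨e₁,e₂⟩}) · n`, `n ∈ N_Q` -/

/-- `q₀₀` is a unit for `q ∈ Q` (`σ(q₃₃) · q₀₀ = 1`, ★ F4-1d). [cite: Casselman1980, §3] -/
theorem isUnit_apply_zero_zero_of_mem_klingen {q : unitaryGroupOfForm σ ((StdForm.antidiagonal 4).over R)} (hq : q ∈ klingen R σ) :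
    IsUnit (((q : GL (Fin 4) R) : Matrix (Fin 4) (Fin 4) R) 0 0) :=
  IsUnit.of_mul_eq_one_right _ (col_zero_unitarity_of_mem_klingen hq).2.2

/-- **THE MIDDLE BLOCK OF `q ∈ Q` IS UNITARY FOR `J₂`**: with `g′ = (q₁₁ q₁₂; q₂₁ q₂₂)`, `σ(g′)ᵀ · antidiag(1,1) · g′ = antidiag(1,1)` (unitarity of `q` on the middle block,
the cross terms dying by `q₁₀ = q₂₀ = q₃₀ = 0` and ★ F4-1d `q₃₁ = q₃₂ = 0`). [cite: Rogawski1990, §1.10] [cite: BruhatTits1972, (4.4.3)] -/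
theorem midBlock_unitarity_of_mem_klingen (hσ : ∀ x, σ (σ x) = x) {q : unitaryGroupOfForm σ ((StdForm.antidiagonal 4).over R)} (hq : q ∈ klingen R σ) :
    ((!![((q : GL (Fin 4) R) : Matrix (Fin 4) (Fin 4) R) 1 1, ((q : GL (Fin 4) R) : Matrix (Fin 4) (Fin 4) R) 1 2;
        ((q : GL (Fin 4) R) : Matrix (Fin 4) (Fin 4) R) 2 1, ((q : GL (Fin 4) R) : Matrix (Fin 4) (Fin 4) R) 2 2] : Matrix (Fin 2) (Fin 2) R).map σ)ᵀ *
        antidiagTwo R *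
        !![((q : GL (Fin 4) R) : Matrix (Fin 4) (Fin 4) R) 1 1, ((q : GL (Fin 4) R) : Matrix (Fin 4) (Fin 4) R) 1 2;
          ((q : GL (Fin 4) R) : Matrix (Fin 4) (Fin 4) R) 2 1, ((q : GL (Fin 4) R) : Matrix (Fin 4) (Fin 4) R) 2 2] =
      antidiagTwo R := by
  obtain ⟨-, h31, h32⟩ := row_three_of_mem_klingen hσ hq
  have h := mem_unitaryGroupOfForm_iff.1 q.2
  have e11 := congrFun (congrFun h 1) 1
  have e12 := congrFun (congrFun h 1) 2
  have e21 := congrFun (congrFun h 2) 1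
  have e22 := congrFun (congrFun h 2) 2
  simp [antidiagonal_over_four, antidiagFour, Matrix.mul_apply, Fin.sum_univ_four, h31, h32] at e11 e12 e21 e22
  ext i j
  fin_cases i <;> fin_cases j <;>
    simp [antidiagTwo, Matrix.mul_apply, Fin.sum_univ_two] <;>
    first
    | linear_combination e11
    | linear_combination e12
    | linear_combination e21
    | linear_combination e22

/-- **row `1` of `m_Q(a, g′) · x` is `g′₀₀ · (row 1 of x) + g′₀₁ · (row 2 of x)`**. [cite: Xiong2013, §7 Lemma 7.1] -/
theorem klingenLevi_mul_apply_one (hσ : ∀ x, σ (σ x) = x) (a : Rˣ) (g : unitaryGroupOfForm σ ((StdForm.antidiagonal 2).over R))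
    (x : unitaryGroupOfForm σ ((StdForm.antidiagonal 4).over R)) (j : Fin 4) :
    (((klingenLevi R σ hσ a g * x : unitaryGroupOfForm σ _) : GL (Fin 4) R) : Matrix (Fin 4) (Fin 4) R) 1 j =
      ((g : GL (Fin 2) R) : Matrix (Fin 2) (Fin 2) R) 0 0 * ((x : GL (Fin 4) R) : Matrix (Fin 4) (Fin 4) R) 1 j +
        ((g : GL (Fin 2) R) : Matrix (Fin 2) (Fin 2) R) 0 1 * ((x : GL (Fin 4) R) : Matrix (Fin 4) (Fin 4) R) 2 j := by
  rw [Subgroup.coe_mul, Units.val_mul, Matrix.mul_apply, coe_klingenLevi]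
  simp [klingenLeviM, Fin.sum_univ_four]

/-- `m_Q(a, g′)⁻¹ = m_Q(a⁻¹, g′⁻¹)`. [cite: MoeglinWaldspurger1995, I.2.1] -/
theorem klingenLevi_inv (hσ : ∀ x, σ (σ x) = x) (a : Rˣ) (g : unitaryGroupOfForm σ ((StdForm.antidiagonal 2).over R)) :
    (klingenLevi R σ hσ a g)⁻¹ = klingenLevi R σ hσ a⁻¹ g⁻¹ :=
  inv_eq_of_mul_eq_one_right (by rw [klingenLevi_mul, mul_inv_cancel, mul_inv_cancel, klingenLevi_one])

/-- **THE LEVI DECOMPOSITION OF THE KLINGEN PARABOLIC**: every `q ∈ Q` is `q = m_Q(a, g′) · n` with `n ∈ N_Q`, `a = q₀₀` and `g′ = q|_{⟨e₁,e₂⟩}` (the middle block, an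
element of `U(J₂)(R, σ)` — E1's `U(Φ₂)`); the matrix of `g′` is given BY VALUE.  (`n = m⁻¹ q` has first column `e₀` and middle block `g′⁻¹ g′ = 1`, hence lies in `N_Q` by
★ F4-1e `mem_klingenUnip_iff_entries`.)  `Q = M_Q ⋉ N_Q`. [cite: MoeglinWaldspurger1995, I.2.1] [cite: Rogawski1990, §1.10] [cite: BruhatTits1972, (4.4.3)] [cite: Xiong2013, §7 Lemma 7.1] -/
theorem exists_klingenLevi_mul_eq (hσ : ∀ x, σ (σ x) = x) {q : unitaryGroupOfForm σ ((StdForm.antidiagonal 4).over R)} (hq : q ∈ klingen R σ) :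
    ∃ (a : Rˣ) (g : unitaryGroupOfForm σ ((StdForm.antidiagonal 2).over R)) (n : unitaryGroupOfForm σ ((StdForm.antidiagonal 4).over R)),
      n ∈ klingenUnip R σ hσ ∧ (a : R) = ((q : GL (Fin 4) R) : Matrix (Fin 4) (Fin 4) R) 0 0 ∧
      ((g : GL (Fin 2) R) : Matrix (Fin 2) (Fin 2) R) =
        !![((q : GL (Fin 4) R) : Matrix (Fin 4) (Fin 4) R) 1 1, ((q : GL (Fin 4) R) : Matrix (Fin 4) (Fin 4) R) 1 2;
          ((q : GL (Fin 4) R) : Matrix (Fin 4) (Fin 4) R) 2 1, ((q : GL (Fin 4) R) : Matrix (Fin 4) (Fin 4) R) 2 2] ∧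
      q = klingenLevi R σ hσ a g * n := by
  -- the unit `a = q₀₀`
  have hav : (((isUnit_apply_zero_zero_of_mem_klingen hq).unit : Rˣ) : R) = ((q : GL (Fin 4) R) : Matrix (Fin 4) (Fin 4) R) 0 0 :=
    IsUnit.unit_spec _
  set a : Rˣ := (isUnit_apply_zero_zero_of_mem_klingen hq).unit with ha
  -- the middle block `g′` as an element of `U(J₂)` (inverse `J₂ σ(g′)ᵀ J₂`)
  set M : Matrix (Fin 2) (Fin 2) R :=
    !![((q : GL (Fin 4) R) : Matrix (Fin 4) (Fin 4) R) 1 1, ((q : GL (Fin 4) R) : Matrix (Fin 4) (Fin 4) R) 1 2;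
      ((q : GL (Fin 4) R) : Matrix (Fin 4) (Fin 4) R) 2 1, ((q : GL (Fin 4) R) : Matrix (Fin 4) (Fin 4) R) 2 2] with hM
  have hMu : (M.map σ)ᵀ * antidiagTwo R * M = antidiagTwo R := midBlock_unitarity_of_mem_klingen hσ hq
  have h2 : antidiagTwo R * (M.map σ)ᵀ * antidiagTwo R * M = 1 := by
    rw [Matrix.mul_assoc (antidiagTwo R), Matrix.mul_assoc (antidiagTwo R), hMu, antidiagTwo_mul_self]
  set gGL : GL (Fin 2) R := ⟨M, antidiagTwo R * (M.map σ)ᵀ * antidiagTwo R, mul_eq_one_comm.1 h2, h2⟩ with hgGL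
  have hgmem : gGL ∈ unitaryGroupOfForm σ ((StdForm.antidiagonal 2).over R) := by
    rw [mem_unitaryGroupOfForm_iff, antidiagonal_over_two]; exact hMu
  set g : unitaryGroupOfForm σ ((StdForm.antidiagonal 2).over R) := ⟨gGL, hgmem⟩ with hg
  have hgM : ((g : GL (Fin 2) R) : Matrix (Fin 2) (Fin 2) R) = M := rfl
  have hgi : (((g⁻¹ : unitaryGroupOfForm σ ((StdForm.antidiagonal 2).over R)) : GL (Fin 2) R) : Matrix (Fin 2) (Fin 2) R) =
      antidiagTwo R * (M.map σ)ᵀ * antidiagTwo R := rfl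
  -- entries of `g′⁻¹ g′ = 1`
  have i00 := congrFun (congrFun h2 0) 0
  have i01 := congrFun (congrFun h2 0) 1
  have i10 := congrFun (congrFun h2 1) 0
  have i11 := congrFun (congrFun h2 1) 1
  rw [Matrix.mul_apply, Fin.sum_univ_two] at i00 i01 i10 i11
  simp only [hM, Matrix.of_apply, Matrix.cons_val', Matrix.cons_val_zero, Matrix.cons_val_one, Matrix.empty_val', Matrix.cons_val_fin_one,
    Matrix.one_apply_eq, Matrix.one_apply_ne (show (0 : Fin 2) ≠ 1 by decide), Matrix.one_apply_ne (show (1 : Fin 2) ≠ 0 by decide)] at i00 i01 i10 i11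
  -- the unipotent part `n = m⁻¹ q`
  refine ⟨a, g, (klingenLevi R σ hσ a g)⁻¹ * q, ?_, hav, hgM, by rw [mul_inv_cancel_left]⟩
  have hmem : (klingenLevi R σ hσ a g)⁻¹ * q ∈ klingen R σ := (klingen R σ).mul_mem ((klingen R σ).inv_mem (klingenLevi_mem_klingen hσ a g)) hq
  obtain ⟨n10, n20, n30⟩ := hmem
  rw [mem_klingenUnip_iff_entries hσ]
  rw [klingenLevi_inv] at n10 n20 n30 ⊢
  refine ⟨?_, n10, n20, n30, ?_, ?_, ?_, ?_⟩
  · rw [klingenLevi_mul_apply_zero, ← hav, Units.inv_mul]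
  · rw [klingenLevi_mul_apply_one, hgi]; linear_combination i00
  · rw [klingenLevi_mul_apply_one, hgi]; linear_combination i01
  · rw [klingenLevi_mul_apply_two, hgi]; linear_combination i10
  · rw [klingenLevi_mul_apply_two, hgi]; linear_combination i11

end Summit.HodgeConjecture.HodgeConjecture.Cruxes.HLiu418.K2LiuKlingenLeviDecomposition

end
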